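import Summits.Ventures.WeilGRH.TwistedGramAnyParity
import Summits.RiemannHypothesis.RiemannHypothesis.Theorems.WeilFormatCPrimeFormBound
import HarnessLib

/-!
# GRH arm (rh-explicit, venture WeilGRH): the TWISTED prime block is `⪰ −A_op⁺·1` and `⪯ A_op⁺·1` on every
  finite set of modes — the far-coercivity prime piece (L-C3a) for a character's Gram kernel

Cell `rh-explicit`, WEIL TRACK — GRH ARM (lit/typing seat weil-grh-5 gen11).  Twisted analogue of weil-10's
`WeilFormatC.primeCoeff_form_ge` (`WeilFormatCPrimeFormBound.lean`, FORMATC-DESIGN §4.3 PRIME): for weights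
`w : ℕ → ℝ` with `|w k| ≤ 1` (a real character's `χ(k) ∈ {0, ±1}`, or `Re χ(k)` in general), every finite `s ⊆ ℤ`
and all `c : ℤ → ℂ`,

  `|Σ_{n,m∈s} Re(conj c_n · c_m) · Σ_{log k<2a} w_k Λ(k)k^{−1/2}(K_{log k}(n,m) − 2δ_{nm})| ≤ A_op⁺(a) · Σ_{n∈s}|c_n|²`,
  `A_op⁺(a) = Σ_{k∈weilPrimeIndex a} Λ(k)k^{−1/2}·2cos(π/(⌊2a/log k⌋ + 2))`

(`K_t = Yoshida1992.incrCoeff a t`): the SAME path-graph constant as for `ζ` — the character only re-weights the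
shifts by numbers of modulus `≤ 1`.  Ingredients: weil-10's identity
`Σ Re(conj c_n c_m)(K_t(n,m) − 2δ) = −2 Re ∫ f(x+t) conj f(x) dx` (`f = Σ c_nχ_n`) and the window shift bound made
TWO-SIDED (`two_mul_abs_re_integral_shift_mul_conj_le`, from `WeilFormatC.two_mul_abs_integral_shift_mul_le` on
`Re f`, `Im f`); for complex weights the MODULUS version `two_mul_norm_integral_shift_mul_conj_le`
(`|∫ f(x+t) conj f(x)| ≤ cos(π/(N+1))‖f‖²`, by modulating `f` with the phase `e^{iθx}` — the numerical radius of a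
nilpotent Jordan block) is recorded for the hermitian kernels `twistedGramCoeffC`.

Then the kernel split used by the far assembly (`TwistedFarAssembly.lean`):
`twistedGramCoeff χ a n m = archCoeff a n m + Σ_k Re χ(k)·Λ(k)k^{−1/2}(K_{log k}(n,m) − 2δ_{nm}) + (log q)δ_{nm}`
(`twistedGramCoeff_eq_arch_add_prime_add_conductor`; no pole term), and the bound specialised to `w = Re χ`.

No definitions; no named facts; RH/GRH-free; standard axioms.
-/

set_option autoImplicit false

noncomputable section

open Complex Set MeasureTheory Finset
open scoped Real ComplexConjugate BigOperators ArithmeticFunction.vonMangoldt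

namespace Summit.Ventures.WeilGRH

open Literature.NumberTheory.LFunctions
open Literature.NumberTheory.LFunctions.Yoshida1992 (modes chi freq gramCoeff polarCoeff incrCoeff primeCoeff
  archCoeff)
open Summit.RiemannHypothesis.RiemannHypothesis.Theorems.WeilFormatC

variable {q : ℕ} {a : ℝ}

/-! ## Two-sided and modulus forms of the window shift bound -/

section Shift

variable {f : ℝ → ℂ}

/-- Whole-line, TWO-SIDED form of `WeilFormatC.two_mul_abs_integral_shift_mul_le` for a bounded measurable real `g`
vanishing off `[−a, a]`: `2|∫ g(x+t)g(x)dx| ≤ 2cos(π/(N+1))∫g²` (`0 < t`, `1 ≤ N`, `2a < Nt`). -/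
theorem two_mul_abs_integral_shift_mul_le_real (ha : 0 ≤ a) {g : ℝ → ℝ} {C : ℝ} (hg : Measurable g)
    (hC : ∀ x, |g x| ≤ C) (hsupp : ∀ x, x ∉ Icc (-a) a → g x = 0) {t : ℝ} (ht : 0 < t) {N : ℕ} (hN1 : 1 ≤ N)
    (hN : 2 * a < N * t) :
    2 * |∫ x, g (x + t) * g x| ≤ 2 * Real.cos (π / (N + 1)) * ∫ x, g x ^ 2 := by
  rw [integral_shift_mul_eq_intervalIntegral ha hsupp t,
    integral_eq_intervalIntegral_of_window ha (fun x hx ↦ by rw [hsupp x hx]; ring)]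
  exact two_mul_abs_integral_shift_mul_le hg hC hsupp ht hN1 hN

/-- **Two-sided shift bound for complex window functions.**  For a window function `f` on `[−a, a]` (`0 ≤ a`),
`0 < t`, `N ≥ 1` with `2a < N t`:  `2 |Re ∫ f(x+t) conj f(x) dx| ≤ 2cos(π/(N+1)) ∫ ‖f‖²`. -/
theorem two_mul_abs_re_integral_shift_mul_conj_le (ha : 0 ≤ a) (hf : IsWindowFunction a f) {t : ℝ}
    (ht : 0 < t) {N : ℕ} (hN1 : 1 ≤ N) (hN : 2 * a < N * t) :
    2 * |(∫ x, f (x + t) * conj (f x)).re| ≤ 2 * Real.cos (π / (N + 1)) * ∫ x, ‖f x‖ ^ 2 := by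
  obtain ⟨S, hS0, hS⟩ := hf.bounded'
  have hre : ∀ x, |(f x).re| ≤ S := fun x ↦ (Complex.abs_re_le_norm _).trans (hS x)
  have him : ∀ x, |(f x).im| ≤ S := fun x ↦ (Complex.abs_im_le_norm _).trans (hS x)
  have hmr : Measurable fun x ↦ (f x).re := Complex.measurable_re.comp hf.measurable
  have hmi : Measurable fun x ↦ (f x).im := Complex.measurable_im.comp hf.measurable
  have hzr : ∀ x, x ∉ Icc (-a) a → (f x).re = 0 := fun x hx ↦ by rw [hf.eq_zero x hx, Complex.zero_re]
  have hzi : ∀ x, x ∉ Icc (-a) a → (f x).im = 0 := fun x hx ↦ by rw [hf.eq_zero x hx, Complex.zero_im]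
  have i1 := integrable_shift_mul_of_window hmr hre hmr hre hzr t
  have i2 := integrable_shift_mul_of_window hmi him hmi him hzi t
  rw [re_integral_shift_mul_conj hf t, integral_add i1 i2, integral_norm_sq_eq_add hf]
  have b1 := two_mul_abs_integral_shift_mul_le_real (g := fun x ↦ (f x).re) ha hmr hre hzr ht hN1 hN
  have b2 := two_mul_abs_integral_shift_mul_le_real (g := fun x ↦ (f x).im) ha hmi him hzi ht hN1 hN
  have habs := abs_add_le (∫ x, (f (x + t)).re * (f x).re) (∫ x, (f (x + t)).im * (f x).im)
  linarith

/-- Modulation by a phase keeps the window class: `x ↦ e^{iθx} f(x)` is a window function when `f` is. -/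
theorem isWindowFunction_modulate (hf : IsWindowFunction a f) (θ : ℝ) :
    IsWindowFunction a (fun x ↦ cexp (I * ((θ * x : ℝ) : ℂ)) * f x) := by
  obtain ⟨S, hS0, hS⟩ := hf.bounded'
  obtain ⟨L, hL⟩ := hf.lipschitz
  have hme : Measurable fun x : ℝ ↦ cexp (I * ((θ * x : ℝ) : ℂ)) :=
    ((Complex.measurable_ofReal.comp (measurable_const.mul measurable_id)).const_mul I).cexp
  refine ⟨hme.mul hf.measurable, fun x hx ↦ by simp only [hf.eq_zero x hx, mul_zero], ⟨S, fun x ↦ ?_⟩,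
    ⟨L + |θ| * S, fun x y hx hy ↦ ?_⟩⟩
  · rw [norm_mul, Complex.norm_exp_I_mul_ofReal, one_mul]; exact hS x
  · have e : cexp (I * ((θ * y : ℝ) : ℂ)) * f y - cexp (I * ((θ * x : ℝ) : ℂ)) * f x
        = cexp (I * ((θ * y : ℝ) : ℂ)) * (f y - f x)
          + cexp (I * ((θ * x : ℝ) : ℂ)) * (cexp (I * ((θ * (y - x) : ℝ) : ℂ)) - 1) * f x := by
      have hexp : cexp (I * ((θ * y : ℝ) : ℂ))
          = cexp (I * ((θ * x : ℝ) : ℂ)) * cexp (I * ((θ * (y - x) : ℝ) : ℂ)) := by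
        rw [← Complex.exp_add]; congr 1; push_cast; ring
      rw [hexp]; ring
    rw [e]
    refine (norm_add_le _ _).trans ?_
    rw [norm_mul, Complex.norm_exp_I_mul_ofReal, one_mul, norm_mul, norm_mul, Complex.norm_exp_I_mul_ofReal,
      one_mul, add_mul]
    refine add_le_add (hL x y hx hy) ?_
    have h1 : ‖cexp (I * ((θ * (y - x) : ℝ) : ℂ)) - 1‖ ≤ |θ| * |y - x| := by
      refine Real.norm_exp_I_mul_ofReal_sub_one_le.trans ?_
      rw [Real.norm_eq_abs, abs_mul]
    calc ‖cexp (I * ((θ * (y - x) : ℝ) : ℂ)) - 1‖ * ‖f x‖ ≤ (|θ| * |y - x|) * S :=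
          mul_le_mul h1 (hS x) (norm_nonneg _) (by positivity)
      _ = |θ| * S * |y - x| := by ring

/-- The shifted inner product of the modulated window: `∫ f_θ(x+t) conj f_θ(x) dx = e^{iθt} ∫ f(x+t) conj f(x) dx`,
`f_θ(x) = e^{iθx} f(x)`. -/
theorem integral_modulate_shift_mul_conj (f : ℝ → ℂ) (θ t : ℝ) :
    ∫ x, (cexp (I * ((θ * (x + t) : ℝ) : ℂ)) * f (x + t)) * conj (cexp (I * ((θ * x : ℝ) : ℂ)) * f x)
      = cexp (I * ((θ * t : ℝ) : ℂ)) * ∫ x, f (x + t) * conj (f x) := by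
  rw [← integral_const_mul]
  congr 1; ext x
  have hconj : conj (cexp (I * ((θ * x : ℝ) : ℂ))) = cexp (-(I * ((θ * x : ℝ) : ℂ))) := by
    rw [← Complex.exp_conj, map_mul, Complex.conj_I, Complex.conj_ofReal, neg_mul]
  have hexp : cexp (I * ((θ * (x + t) : ℝ) : ℂ)) * cexp (-(I * ((θ * x : ℝ) : ℂ))) = cexp (I * ((θ * t : ℝ) : ℂ)) := by
    rw [← Complex.exp_add]; congr 1; push_cast; ring
  rw [map_mul, hconj]
  calc cexp (I * ((θ * (x + t) : ℝ) : ℂ)) * f (x + t) * (cexp (-(I * ((θ * x : ℝ) : ℂ))) * conj (f x))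
      = (cexp (I * ((θ * (x + t) : ℝ) : ℂ)) * cexp (-(I * ((θ * x : ℝ) : ℂ)))) * (f (x + t) * conj (f x)) := by
        ring
    _ = cexp (I * ((θ * t : ℝ) : ℂ)) * (f (x + t) * conj (f x)) := by rw [hexp]

/-- **Modulus shift bound** (numerical radius of the window shift).  For a window function `f` on `[−a, a]`
(`0 ≤ a`), `0 < t`, `N ≥ 1` with `2a < N t`:  `2 ‖∫ f(x+t) conj f(x) dx‖ ≤ 2cos(π/(N+1)) ∫ ‖f‖²` — the real-part
bound applied to the modulated window `e^{iθx}f(x)` whose phase `e^{iθt}` turns the inner product real. -/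
theorem two_mul_norm_integral_shift_mul_conj_le (ha : 0 ≤ a) (hf : IsWindowFunction a f) {t : ℝ} (ht : 0 < t)
    {N : ℕ} (hN1 : 1 ≤ N) (hN : 2 * a < N * t) :
    2 * ‖∫ x, f (x + t) * conj (f x)‖ ≤ 2 * Real.cos (π / (N + 1)) * ∫ x, ‖f x‖ ^ 2 := by
  set J : ℂ := ∫ x, f (x + t) * conj (f x) with hJ
  by_cases hJ0 : J = 0
  · rw [hJ0, norm_zero, mul_zero]
    refine mul_nonneg (mul_nonneg zero_le_two (Real.cos_nonneg_of_mem_Icc ⟨?_, ?_⟩))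
      (integral_nonneg fun x ↦ by positivity)
    · have : 0 ≤ π / (N + 1) := by positivity
      linarith [Real.pi_pos]
    · rw [div_le_iff₀ (by positivity)]
      have h2 : (2 : ℝ) ≤ N + 1 := by exact_mod_cast Nat.succ_le_succ hN1
      nlinarith [Real.pi_pos]
  -- the phase: `‖J‖ e^{iφ} = conj J`, `θ = φ/t`
  set φ : ℝ := Complex.arg (conj J) with hφ
  set θ : ℝ := φ / t with hθ
  have hphase : cexp (I * ((θ * t : ℝ) : ℂ)) * J = (‖J‖ : ℂ) := by
    have h1 : ((‖conj J‖ : ℝ) : ℂ) * cexp ((φ : ℂ) * I) = conj J := Complex.norm_mul_exp_arg_mul_I (conj J)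
    rw [Complex.norm_conj] at h1
    have hθt : ((θ * t : ℝ) : ℂ) = (φ : ℂ) := by rw [hθ, div_mul_cancel₀ φ ht.ne']
    rw [hθt, mul_comm I]
    have hJJ : conj J * J = ((‖J‖ : ℝ) : ℂ) ^ 2 := by rw [mul_comm, Complex.mul_conj, Complex.normSq_eq_norm_sq]; push_cast; ring
    have hn0 : ((‖J‖ : ℝ) : ℂ) ≠ 0 := by exact_mod_cast (norm_ne_zero_iff.mpr hJ0)
    have e2 : cexp ((φ : ℂ) * I) = conj J / ((‖J‖ : ℝ) : ℂ) := by
      rw [eq_div_iff hn0, mul_comm, h1]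
    rw [e2, div_mul_eq_mul_div, hJJ, pow_two, mul_div_assoc, div_self hn0, mul_one]
  -- the modulated window
  have hfθ := isWindowFunction_modulate hf θ
  have hb := two_mul_re_integral_shift_mul_conj_le ha hfθ ht hN1 hN
  have hint : ∫ x, (fun x ↦ cexp (I * ((θ * x : ℝ) : ℂ)) * f x) (x + t) *
      conj ((fun x ↦ cexp (I * ((θ * x : ℝ) : ℂ)) * f x) x) = cexp (I * ((θ * t : ℝ) : ℂ)) * J :=
    integral_modulate_shift_mul_conj f θ t
  have hnorm : ∫ x, ‖(fun x ↦ cexp (I * ((θ * x : ℝ) : ℂ)) * f x) x‖ ^ 2 = ∫ x, ‖f x‖ ^ 2 := by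
    congr 1; ext x
    simp only [norm_mul, Complex.norm_exp_I_mul_ofReal, one_mul]
  rw [hint, hphase, hnorm, Complex.ofReal_re] at hb
  exact hb

end Shift

/-! ## The twisted prime block on trigonometric windows -/

section Prime

/-- **One length, one weight.**  For `k` with `log k < 2a`, `|w| ≤ 1` and `f = Σ_{n∈s} c_nχ_n`:
`|w·Λ(k)k^{−1/2}·Σ_nΣ_m Re(conj c_n c_m)(K_{log k}(n,m) − 2δ_{nm})| ≤ Λ(k)k^{−1/2}·2cos(π/(⌊2a/log k⌋+2))·Σ|c_n|²`. -/
theorem abs_weight_mul_vonMangoldt_mul_incr_form_le (ha : 0 < a) (s : Finset ℤ) (c : ℤ → ℂ) {k : ℕ}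
    (hk : k ∈ weilPrimeIndex a) {w : ℝ} (hw : |w| ≤ 1) :
    |w * ((Λ k : ℝ) / Real.sqrt k) *
        ∑ n ∈ s, ∑ m ∈ s, (conj (c n) * c m).re * (incrCoeff a (Real.log k) n m - if n = m then 2 else 0)|
      ≤ (Λ k : ℝ) / Real.sqrt k * (2 * Real.cos (π / (⌊2 * a / Real.log k⌋₊ + 2))) * ∑ n ∈ s, ‖c n‖ ^ 2 := by
  by_cases hΛ : (Λ k : ℝ) = 0
  · rw [hΛ]; simp
  have hk2 : 2 ≤ k := by
    by_contra h
    have : k = 0 ∨ k = 1 := by omega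
    rcases this with rfl | rfl
    · exact hΛ (by simp)
    · exact hΛ (by simp)
  have ht : 0 < Real.log k := Real.log_pos (by exact_mod_cast hk2)
  have ht2 : Real.log k ≤ 2 * a := (mem_weilPrimeIndex.1 hk).le
  have hwΛ : 0 ≤ (Λ k : ℝ) / Real.sqrt k :=
    div_nonneg ArithmeticFunction.vonMangoldt_nonneg (Real.sqrt_nonneg _)
  set N : ℕ := ⌊2 * a / Real.log k⌋₊ + 1 with hN
  have hN1 : 1 ≤ N := by omega
  have hNt : 2 * a < N * Real.log k := by
    have h := Nat.lt_floor_add_one (2 * a / Real.log k)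
    rw [div_lt_iff₀ ht] at h
    exact_mod_cast h
  have hf : IsWindowFunction a (∑ n ∈ s, c n • chi a n) :=
    IsWindowFunction.sum s c fun n _ ↦ isWindowFunction_chi ha n
  have hb := two_mul_abs_re_integral_shift_mul_conj_le ha.le hf ht hN1 hNt
  rw [integral_norm_sq_sum_smul_chi ha s c] at hb
  have hcast : ((N : ℝ) + 1) = (⌊2 * a / Real.log k⌋₊ : ℝ) + 2 := by
    rw [hN]; push_cast; ring
  rw [hcast] at hb
  rw [sum_sum_re_mul_incrCoeff_sub_two_eq ha s c ht.le ht2, abs_mul, abs_mul, abs_of_nonneg hwΛ]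
  set R := (∫ x, (∑ n ∈ s, c n • chi a n) (x + Real.log k) * conj ((∑ n ∈ s, c n • chi a n) x)).re with hR
  have hR2 : |-2 * R| = 2 * |R| := by rw [abs_mul, abs_neg, abs_two]
  rw [hR2]
  have hcos : 0 ≤ 2 * Real.cos (π / (⌊2 * a / Real.log k⌋₊ + 2)) * ∑ n ∈ s, ‖c n‖ ^ 2 :=
    le_trans (by positivity) hb
  calc |w| * ((Λ k : ℝ) / Real.sqrt k) * (2 * |R|)
      ≤ 1 * ((Λ k : ℝ) / Real.sqrt k) * (2 * Real.cos (π / (⌊2 * a / Real.log k⌋₊ + 2)) * ∑ n ∈ s, ‖c n‖ ^ 2) :=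
        mul_le_mul (mul_le_mul_of_nonneg_right hw hwΛ) hb (by positivity) (by positivity)
    _ = _ := by ring

/-- **TWISTED PRIME, absolute bound on every finite set of modes.**  For `a > 0`, weights `w : ℕ → ℝ` with
`|w k| ≤ 1`, every finite `s ⊆ ℤ` and all `c : ℤ → ℂ`:
`|Σ_{n,m∈s} Re(conj c_n c_m)·Σ_{k∈weilPrimeIndex a} w_k Λ(k)k^{−1/2}(K_{log k}(n,m) − 2δ_{nm})| ≤ A_op⁺(a)·Σ_{n∈s}|c_n|²`. -/
theorem abs_twistedPrime_form_le (ha : 0 < a) (w : ℕ → ℝ) (hw : ∀ k, |w k| ≤ 1) (s : Finset ℤ) (c : ℤ → ℂ) :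
    |∑ n ∈ s, ∑ m ∈ s, (conj (c n) * c m).re *
        ∑ k ∈ weilPrimeIndex a, w k * ((Λ k : ℝ) / Real.sqrt k) *
          (incrCoeff a (Real.log k) n m - if n = m then 2 else 0)|
      ≤ (∑ k ∈ weilPrimeIndex a, (Λ k : ℝ) / Real.sqrt k * (2 * Real.cos (π / (⌊2 * a / Real.log k⌋₊ + 2)))) *
        ∑ n ∈ s, ‖c n‖ ^ 2 := by
  have e : ∑ n ∈ s, ∑ m ∈ s, (conj (c n) * c m).re *
        ∑ k ∈ weilPrimeIndex a, w k * ((Λ k : ℝ) / Real.sqrt k) *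
          (incrCoeff a (Real.log k) n m - if n = m then 2 else 0)
      = ∑ k ∈ weilPrimeIndex a, w k * ((Λ k : ℝ) / Real.sqrt k) *
          ∑ n ∈ s, ∑ m ∈ s, (conj (c n) * c m).re * (incrCoeff a (Real.log k) n m - if n = m then 2 else 0) := by
    calc ∑ n ∈ s, ∑ m ∈ s, (conj (c n) * c m).re *
          ∑ k ∈ weilPrimeIndex a, w k * ((Λ k : ℝ) / Real.sqrt k) *
            (incrCoeff a (Real.log k) n m - if n = m then 2 else 0)
        = ∑ n ∈ s, ∑ m ∈ s, ∑ k ∈ weilPrimeIndex a, w k * ((Λ k : ℝ) / Real.sqrt k) *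
            ((conj (c n) * c m).re * (incrCoeff a (Real.log k) n m - if n = m then 2 else 0)) := by
          refine Finset.sum_congr rfl fun n _ ↦ Finset.sum_congr rfl fun m _ ↦ ?_
          rw [Finset.mul_sum]
          refine Finset.sum_congr rfl fun k _ ↦ by ring
      _ = ∑ n ∈ s, ∑ k ∈ weilPrimeIndex a, ∑ m ∈ s, w k * ((Λ k : ℝ) / Real.sqrt k) *
            ((conj (c n) * c m).re * (incrCoeff a (Real.log k) n m - if n = m then 2 else 0)) :=
          Finset.sum_congr rfl fun n _ ↦ Finset.sum_comm
      _ = ∑ k ∈ weilPrimeIndex a, ∑ n ∈ s, ∑ m ∈ s, w k * ((Λ k : ℝ) / Real.sqrt k) *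
            ((conj (c n) * c m).re * (incrCoeff a (Real.log k) n m - if n = m then 2 else 0)) :=
          Finset.sum_comm
      _ = _ := by
          refine Finset.sum_congr rfl fun k _ ↦ ?_
          rw [Finset.mul_sum]
          refine Finset.sum_congr rfl fun n _ ↦ ?_
          rw [Finset.mul_sum]
  rw [e, Finset.sum_mul]
  refine (Finset.abs_sum_le_sum_abs _ _).trans (Finset.sum_le_sum fun k hk ↦ ?_)
  exact abs_weight_mul_vonMangoldt_mul_incr_form_le ha s c hk (hw k)

/-- **TWISTED PRIME ⪰ −A_op⁺·1** (lower form of `abs_twistedPrime_form_le`). -/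
theorem twistedPrime_form_ge (ha : 0 < a) (w : ℕ → ℝ) (hw : ∀ k, |w k| ≤ 1) (s : Finset ℤ) (c : ℤ → ℂ) :
    -((∑ k ∈ weilPrimeIndex a, (Λ k : ℝ) / Real.sqrt k * (2 * Real.cos (π / (⌊2 * a / Real.log k⌋₊ + 2)))) *
        ∑ n ∈ s, ‖c n‖ ^ 2)
      ≤ ∑ n ∈ s, ∑ m ∈ s, (conj (c n) * c m).re *
        ∑ k ∈ weilPrimeIndex a, w k * ((Λ k : ℝ) / Real.sqrt k) *
          (incrCoeff a (Real.log k) n m - if n = m then 2 else 0) :=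
  (abs_le.mp (abs_twistedPrime_form_le ha w hw s c)).1

/-- **TWISTED PRIME ⪯ A_op⁺·1** (upper form of `abs_twistedPrime_form_le`). -/
theorem twistedPrime_form_le (ha : 0 < a) (w : ℕ → ℝ) (hw : ∀ k, |w k| ≤ 1) (s : Finset ℤ) (c : ℤ → ℂ) :
    ∑ n ∈ s, ∑ m ∈ s, (conj (c n) * c m).re *
        ∑ k ∈ weilPrimeIndex a, w k * ((Λ k : ℝ) / Real.sqrt k) *
          (incrCoeff a (Real.log k) n m - if n = m then 2 else 0)
      ≤ (∑ k ∈ weilPrimeIndex a, (Λ k : ℝ) / Real.sqrt k * (2 * Real.cos (π / (⌊2 * a / Real.log k⌋₊ + 2)))) *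
        ∑ n ∈ s, ‖c n‖ ^ 2 :=
  (abs_le.mp (abs_twistedPrime_form_le ha w hw s c)).2

/-- Real-coefficient form of the twisted prime lower bound: `−A_op⁺·Σ x_n² ≤ Σ x_n x_m T_w(n,m)`. -/
theorem twistedPrime_form_ge_real (ha : 0 < a) (w : ℕ → ℝ) (hw : ∀ k, |w k| ≤ 1) (s : Finset ℤ) (x : ℤ → ℝ) :
    -((∑ k ∈ weilPrimeIndex a, (Λ k : ℝ) / Real.sqrt k * (2 * Real.cos (π / (⌊2 * a / Real.log k⌋₊ + 2)))) *
        ∑ n ∈ s, x n ^ 2)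
      ≤ ∑ n ∈ s, ∑ m ∈ s, x n * x m *
        ∑ k ∈ weilPrimeIndex a, w k * ((Λ k : ℝ) / Real.sqrt k) *
          (incrCoeff a (Real.log k) n m - if n = m then 2 else 0) := by
  have h := twistedPrime_form_ge ha w hw s (fun n ↦ ((x n : ℝ) : ℂ))
  have e1 : ∑ n ∈ s, ‖((x n : ℝ) : ℂ)‖ ^ 2 = ∑ n ∈ s, x n ^ 2 :=
    Finset.sum_congr rfl fun n _ ↦ by rw [Complex.norm_real, Real.norm_eq_abs, sq_abs]
  have e2 : ∀ K : ℤ → ℤ → ℝ, ∑ n ∈ s, ∑ m ∈ s, (conj ((x n : ℝ) : ℂ) * ((x m : ℝ) : ℂ)).re * K n m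
      = ∑ n ∈ s, ∑ m ∈ s, x n * x m * K n m := fun K ↦
    Finset.sum_congr rfl fun n _ ↦ Finset.sum_congr rfl fun m _ ↦ by
      rw [Complex.conj_ofReal, ← Complex.ofReal_mul, Complex.ofReal_re]
  rw [e1, e2] at h
  exact h

/-- Reflection symmetry of the twisted prime kernel: `T_w(−n,−m) = T_w(n,m)`. -/
theorem twistedPrime_neg_neg (w : ℕ → ℝ) (a : ℝ) (n m : ℤ) :
    (∑ k ∈ weilPrimeIndex a, w k * ((Λ k : ℝ) / Real.sqrt k) *
        (incrCoeff a (Real.log k) (-n) (-m) - if -n = -m then 2 else 0))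
      = ∑ k ∈ weilPrimeIndex a, w k * ((Λ k : ℝ) / Real.sqrt k) *
        (incrCoeff a (Real.log k) n m - if n = m then 2 else 0) := by
  refine Finset.sum_congr rfl fun k _ ↦ ?_
  rw [incrCoeff_neg_neg]
  simp only [neg_inj]

end Prime

/-! ## The twisted kernel: archimedean part + twisted primes + conductor -/

section Split

/-- **`twistedGramCoeff = archCoeff + Σ_k Re χ(k)·Λ(k)k^{−1/2}(K_{log k} − 2δ) + (log q)δ`** — Yoshida's pole term
cancels and the prime jumps carry the weights `Re χ(k)` (`|Re χ(k)| ≤ 1`). -/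
theorem twistedGramCoeff_eq_arch_add_prime_add_conductor (χ : DirichletCharacter ℂ q) (a : ℝ) (n m : ℤ) :
    twistedGramCoeff χ a n m = archCoeff a n m +
      (∑ k ∈ weilPrimeIndex a, (χ (k : ZMod q)).re * ((Λ k : ℝ) / Real.sqrt k) *
        (incrCoeff a (Real.log k) n m - if n = m then 2 else 0)) +
      if n = m then Real.log q else 0 := by
  unfold twistedGramCoeff
  have hsum : (∑ k ∈ weilPrimeIndex a, (Λ k : ℝ) / Real.sqrt k *
        (incrCoeff a (Real.log k) n m - if n = m then 2 else 0)) +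
      ∑ k ∈ weilPrimeIndex a, ((χ (k : ZMod q)).re - 1) * ((Λ k : ℝ) / Real.sqrt k) *
        (incrCoeff a (Real.log k) n m - if n = m then 2 else 0)
      = ∑ k ∈ weilPrimeIndex a, (χ (k : ZMod q)).re * ((Λ k : ℝ) / Real.sqrt k) *
        (incrCoeff a (Real.log k) n m - if n = m then 2 else 0) := by
    rw [← Finset.sum_add_distrib]
    exact Finset.sum_congr rfl fun k _ ↦ by ring
  rw [Yoshida1992.gramCoeff, Yoshida1992.primeCoeff, ← hsum]
  ring

/-- The weights `Re χ(k)` have modulus `≤ 1`. -/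
theorem abs_re_apply_le_one (χ : DirichletCharacter ℂ q) (k : ℕ) : |(χ (k : ZMod q)).re| ≤ 1 :=
  (Complex.abs_re_le_norm _).trans (DirichletCharacter.norm_le_one χ _)

/-- **The character's prime block is `⪰ −A_op⁺·1`**: the specialisation `w = Re χ` of `twistedPrime_form_ge`
(hypothesis `hPA` of `TwistedFarAssembly.lean` with `A = A_op⁺(a)`). -/
theorem twistedPrime_form_ge_char (χ : DirichletCharacter ℂ q) (ha : 0 < a) (s : Finset ℤ) (c : ℤ → ℂ) :
    -((∑ k ∈ weilPrimeIndex a, (Λ k : ℝ) / Real.sqrt k * (2 * Real.cos (π / (⌊2 * a / Real.log k⌋₊ + 2)))) *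
        ∑ n ∈ s, ‖c n‖ ^ 2)
      ≤ ∑ n ∈ s, ∑ m ∈ s, (conj (c n) * c m).re *
        ∑ k ∈ weilPrimeIndex a, (χ (k : ZMod q)).re * ((Λ k : ℝ) / Real.sqrt k) *
          (incrCoeff a (Real.log k) n m - if n = m then 2 else 0) :=
  twistedPrime_form_ge ha (fun k ↦ (χ (k : ZMod q)).re) (abs_re_apply_le_one χ) s c

end Split

end Summit.Ventures.WeilGRH

end
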